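import Mathlib

/-!
# Route BarrierLever — item `LexDescentCertificatesFail` (stmt-ValiantsHypothesis-19537): PROVED
# (the bit-free lexicographic descent certificate does not always exist)

Closing file (`--workitem stmt-ValiantsHypothesis-19537`; rung V4, 𝒟-side; seat val-lit-p1 g2 for
the ladder's «19537 negation proved by a prover»; statement by planner valiant-natproofs p1-g9; the
scaffold — antipodal star, swap of two indistinguishable rows — is adapted from prover gen 6's
`BarrierLeverDescentCertificatesFail.lean` (item 19579)). Definition-free.

The item is the NEGATION of `LexDescentCertificatesExist` (stmt-19501): «for every injective layout
`(u, w)` there are a coordinate order `ord` and an assignment `π₀` (fixing the common points) whose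
LEX cost — the sum over unmatched columns `j` of
`X^{2h + 2·maxpos Δ_j} + X^{2·max(h−1−pos) Δ_j}` (`X = r+1`, `Δ_j = u(π₀ j) Δ w j`, positions
under `ord`) — is STRICTLY smaller than that of every other admissible assignment».

**Counterexample (the antipodal star, `h = 5`, `r = 6`; the planner's own h = 5 slice witness is
replaced by this smaller one).** Rows `U = {∅, {0}, {1}, {2}, {3}, {4}}`, columns
`W = {univ ∖ {k} : k < 5} ∪ {univ}`; no row is a column. Fix `ord, π₀` and let `x = ord⁻¹(2)` be
the coordinate at the interior position `2`. For every column `W_j` (which misses at most one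
coordinate) the mismatch sets of the rows `∅` and `{x}` are `W_j` and `W_j Δ {x}`: they differ
only in `x` (position `2`, reversed position `2`) while `W_j` keeps a coordinate of position
`≥ 3` and one of position `≤ 1` (reversed position `≥ 3`), so both maxima agree
(`sup_symmDiff_singleton_eq`). Hence `σ = π₀ ∘ (j₁ j₂)`, swapping the columns of these two rows,
has the SAME lex cost as `π₀`, contradicting strictness (`lexDescentCertificatesFail`, the item's
signature verbatim).

WHAT THIS IS NOT: the separable/bit-dependent variants and UT-D itself (stmt-19316) are not
touched; nothing on TT / TNS / 19717, crux 14610, or VP vs VNP.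
-/

-- layout Summits/ValiantsHypothesis/ValiantsHypothesis forces the duplicated namespace component
set_option linter.dupNamespace false

namespace Summit.ValiantsHypothesis.ValiantsHypothesis.Theorems.BarrierLever.LexDescentFail

open Finset

/-- **Sup over a one-point symmetric difference.** If `W` contains some `y ≠ x` with
`g x ≤ g y`, then `sup g` over `{x} Δ W` equals `sup g` over `W`. -/
theorem sup_symmDiff_singleton_eq {α : Type*} [DecidableEq α] (W : Finset α) (x y : α)
    (g : α → ℕ) (hy : y ∈ W) (hyx : y ≠ x) (hle : g x ≤ g y) :
    (symmDiff ({x} : Finset α) W).sup g = W.sup g := by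
  have hyD : y ∈ symmDiff ({x} : Finset α) W := by
    rw [Finset.mem_symmDiff]
    exact Or.inr ⟨hy, by rwa [Finset.mem_singleton]⟩
  refine le_antisymm (Finset.sup_le fun c hc => ?_) (Finset.sup_le fun c hc => ?_)
  · rw [Finset.mem_symmDiff, Finset.mem_singleton] at hc
    rcases hc with ⟨rfl, -⟩ | ⟨hcW, -⟩
    · exact hle.trans (Finset.le_sup hy)
    · exact Finset.le_sup hcW
  · by_cases hcx : c = x
    · subst hcx
      exact hle.trans (Finset.le_sup hyD)
    · exact Finset.le_sup (Finset.mem_symmDiff.mpr (Or.inr ⟨hc, by rwa [Finset.mem_singleton]⟩))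

/-- **Key lemma (lex cost).** Against a column `W ⊆ Fin 5` missing at most one coordinate, the
rows `∅` and `{ord⁻¹ 2}` have the same maximal position and the same maximal reversed position
of their mismatch sets. -/
theorem sups_eq (ord : Equiv.Perm (Fin 5)) (W : Finset (Fin 5))
    (hW : ∀ y z : Fin 5, y ≠ z → y ∈ W ∨ z ∈ W) :
    ((symmDiff ({ord.symm 2} : Finset (Fin 5)) W).image (fun a => ((ord a : Fin 5) : ℕ))).sup id =
      ((symmDiff (∅ : Finset (Fin 5)) W).image (fun a => ((ord a : Fin 5) : ℕ))).sup id ∧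
    ((symmDiff ({ord.symm 2} : Finset (Fin 5)) W).image (fun a => 5 - 1 - ((ord a : Fin 5) : ℕ))).sup id =
      ((symmDiff (∅ : Finset (Fin 5)) W).image (fun a => 5 - 1 - ((ord a : Fin 5) : ℕ))).sup id := by
  have h0 : symmDiff (∅ : Finset (Fin 5)) W = W := by
    rw [← Finset.bot_eq_empty, bot_symmDiff]
  simp only [Finset.sup_image, h0]
  have hx2 : ((ord (ord.symm 2) : Fin 5) : ℕ) = 2 := by
    rw [Equiv.apply_symm_apply]; rfl
  constructor
  · -- a coordinate of position ≥ 3 lies in W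
    obtain ⟨m, hm3, hmW⟩ : ∃ m : Fin 5, 3 ≤ (m : ℕ) ∧ ord.symm m ∈ W := by
      rcases hW (ord.symm 3) (ord.symm 4) (by rw [Ne, ord.symm.injective.eq_iff]; decide)
        with h3 | h4
      · exact ⟨3, le_rfl, h3⟩
      · exact ⟨4, by decide, h4⟩
    refine sup_symmDiff_singleton_eq W (ord.symm 2) (ord.symm m) _ hmW ?_ ?_
    · rw [Ne, ord.symm.injective.eq_iff]
      rintro rfl
      exact absurd hm3 (by decide)
    · show ((ord (ord.symm 2) : Fin 5) : ℕ) ≤ ((ord (ord.symm m) : Fin 5) : ℕ)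
      rw [Equiv.apply_symm_apply, Equiv.apply_symm_apply]
      exact le_trans (by decide) hm3
  · -- a coordinate of position ≤ 1 lies in W
    obtain ⟨m, hm1, hmW⟩ : ∃ m : Fin 5, (m : ℕ) ≤ 1 ∧ ord.symm m ∈ W := by
      rcases hW (ord.symm 0) (ord.symm 1) (by rw [Ne, ord.symm.injective.eq_iff]; decide)
        with h0' | h1
      · exact ⟨0, by decide, h0'⟩
      · exact ⟨1, le_rfl, h1⟩
    refine sup_symmDiff_singleton_eq W (ord.symm 2) (ord.symm m) _ hmW ?_ ?_
    · rw [Ne, ord.symm.injective.eq_iff]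
      rintro rfl
      exact absurd hm1 (by decide)
    · show 5 - 1 - ((ord (ord.symm 2) : Fin 5) : ℕ) ≤ 5 - 1 - ((ord (ord.symm m) : Fin 5) : ℕ)
      rw [Equiv.apply_symm_apply, Equiv.apply_symm_apply]
      have : ((2 : Fin 5) : ℕ) = 2 := rfl
      omega

/-- **Item stmt-ValiantsHypothesis-19537 `LexDescentCertificatesFail` (verbatim signature): the
lexicographic descent certificate of stmt-19501 does not exist for the antipodal star layout.** -/
theorem lexDescentCertificatesFail :
    ¬ (∀ (h r : ℕ) (u w : Fin r → Finset (Fin h)), Function.Injective u → Function.Injective w → ∃ (ord : Equiv.Perm (Fin h)) (π₀ : Equiv.Perm (Fin r)), (∀ j, (∃ i, u i = w j) → u (π₀ j) = w j) ∧ ∀ σ : Equiv.Perm (Fin r), (∀ j, (∃ i, u i = w j) → u (σ j) = w j) → σ ≠ π₀ → (∑ j ∈ Finset.univ.filter (fun j => ∀ i, u i ≠ w j), ((r + 1) ^ (2 * h + 2 * ((symmDiff (u (π₀ j)) (w j)).image (fun a => ((ord a : Fin h) : ℕ))).sup id) + (r + 1) ^ (2 * ((symmDiff (u (π₀ j)) (w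 j)).image (fun a => h - 1 - ((ord a : Fin h) : ℕ))).sup id))) < (∑ j ∈ Finset.univ.filter (fun j => ∀ i, u i ≠ w j), ((r + 1) ^ (2 * h + 2 * ((symmDiff (u (σ j)) (w j)).image (fun a => ((ord a : Fin h) : ℕ))).sup id) + (r + 1) ^ (2 * ((symmDiff (u (σ j)) (w j)).image (fun a => h - 1 - ((ord a : Fin h) : ℕ))).sup id)))) := by
  intro H
  -- the antipodal star at h = 5 (scaffold as in `BarrierLeverDescentCertificatesFail`)
  have hU : Function.Injective
      (![∅, {0}, {1}, {2}, {3}, {4}] : Fin 6 → Finset (Fin 5)) := by decide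
  have hWi : Function.Injective
      (![univ.erase 0, univ.erase 1, univ.erase 2, univ.erase 3, univ.erase 4, univ] :
        Fin 6 → Finset (Fin 5)) := by decide
  have hnomatch : ∀ j i : Fin 6, (![∅, {0}, {1}, {2}, {3}, {4}] : Fin 6 → Finset (Fin 5)) i ≠
      (![univ.erase 0, univ.erase 1, univ.erase 2, univ.erase 3, univ.erase 4, univ] :
        Fin 6 → Finset (Fin 5)) j := by decide
  have hcover : ∀ (j : Fin 6) (y z : Fin 5), y ≠ z →
      y ∈ (![univ.erase 0, univ.erase 1, univ.erase 2, univ.erase 3, univ.erase 4, univ] :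
        Fin 6 → Finset (Fin 5)) j ∨
      z ∈ (![univ.erase 0, univ.erase 1, univ.erase 2, univ.erase 3, univ.erase 4, univ] :
        Fin 6 → Finset (Fin 5)) j := by decide
  have hzero : (![∅, {0}, {1}, {2}, {3}, {4}] : Fin 6 → Finset (Fin 5)) 0 = ∅ := rfl
  have hsucc : ∀ y : Fin 5, (![∅, {0}, {1}, {2}, {3}, {4}] : Fin 6 → Finset (Fin 5)) y.succ = {y} := by
    decide
  obtain ⟨ord, π₀, -, hstrict⟩ := H 5 6 _ _ hU hWi
  set u : Fin 6 → Finset (Fin 5) := ![∅, {0}, {1}, {2}, {3}, {4}] with hu_def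
  set w : Fin 6 → Finset (Fin 5) :=
    ![univ.erase 0, univ.erase 1, univ.erase 2, univ.erase 3, univ.erase 4, univ] with hw_def
  -- the two indistinguishable rows `∅ = u 0` and `{x} = u x.succ`, `x = ord⁻¹ 2`
  set x : Fin 5 := ord.symm 2 with hx
  set j₁ : Fin 6 := π₀.symm 0 with hj₁
  set j₂ : Fin 6 := π₀.symm x.succ with hj₂
  have hπ1 : π₀ j₁ = 0 := π₀.apply_symm_apply 0
  have hπ2 : π₀ j₂ = x.succ := π₀.apply_symm_apply _
  have hj12 : j₁ ≠ j₂ := by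
    intro hh
    have := hπ1.symm.trans ((congrArg π₀ hh).trans hπ2)
    exact (Fin.succ_ne_zero x) this.symm
  set σ : Equiv.Perm (Fin 6) := π₀ * Equiv.swap j₁ j₂ with hσ
  have hσ1 : σ j₁ = x.succ := by
    rw [hσ, Equiv.Perm.mul_apply, Equiv.swap_apply_left, hπ2]
  have hσ2 : σ j₂ = 0 := by
    rw [hσ, Equiv.Perm.mul_apply, Equiv.swap_apply_right, hπ1]
  have hσ3 : ∀ j, j ≠ j₁ → j ≠ j₂ → σ j = π₀ j := fun j h1 h2 => by
    rw [hσ, Equiv.Perm.mul_apply, Equiv.swap_apply_of_ne_of_ne h1 h2]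
  have hne : σ ≠ π₀ := by
    intro hh
    have h1 : σ j₁ = π₀ j₁ := by rw [hh]
    rw [hσ1, hπ1] at h1
    exact Fin.succ_ne_zero x h1
  have hlt := hstrict σ (fun j hj => by obtain ⟨i, hi⟩ := hj; exact absurd hi (hnomatch j i)) hne
  refine absurd hlt (not_lt.mpr (le_of_eq ?_))
  refine Finset.sum_congr rfl fun j _ => ?_
  by_cases h1 : j = j₁
  · rw [h1, hσ1, hπ1, hsucc, hzero]
    obtain ⟨e1, e2⟩ := sups_eq ord (w j₁) (hcover j₁)
    rw [e1, e2]
  · by_cases h2 : j = j₂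
    · rw [h2, hσ2, hπ2, hsucc, hzero]
      obtain ⟨e1, e2⟩ := sups_eq ord (w j₂) (hcover j₂)
      rw [e1, e2]
    · rw [hσ3 j h1 h2]

end Summit.ValiantsHypothesis.ValiantsHypothesis.Theorems.BarrierLever.LexDescentFail
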